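import Summits.QuantumFields.BalabanUV.Beta.FP.RelInvPeriodisedComb
import Summits.QuantumFields.BalabanUV.Beta.FP.RelInvPeriodisedChartMinOpRecord

/-!
# `BalabanUV.Beta.FP.RelInvPeriodisedCombMinOp` — road «FP» (binder row D1), ROUTE T row **(T-INV)** AT THE CHART OF RECORD (III′), the (J-a) dictionary's item
# **(γ-sym)**, TORUS HALF (sequel of `RelInvPeriodisedCombRecord`): **THE `μ`-COLUMNS OF `minOp`, THE `μ`-ROWS OF `minOpL` AND THE FLUCTUATION COVARIANCE `flucCov`
# OF THE COMB-SLICED PERIODISED LEVEL-`j` SYSTEM OF CHART (III′)** — `±Â′` masked by an2's live indicator `axEc ρ_c Lc` on the field slots, `Â′ := perF M (GcombSh Lc j)` —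
# the resolvent-side inputs of the dictionary's `hId₁ ∕ hId₂` junctions (`CoarseJetOrderOne∕TwoGraded` sandwiches) at the sym tables

HONEST DEPENDENCY (page 1, mandatory): continuum YM on T⁴ ⇐ BetaPertH ∧ nine spine estimates (0/9 proved); BetaPertH ⇐ (D1) ∧ (D4) ∧
CAP+tail; G-an2-4 gates asym, D1 and NE2/3/4.  HONEST FRAMING (cell contract, verbatim): «discharging `BetaPertH` makes Bałaban's UV
stability UNCONDITIONAL — a real constructive-QFT result; it is NOT the continuum limit and NOT the Clay problem.»  ABSOLUTE RULE (cell
charter, verbatim): «No internally-minted statement may enter as a cited fact. Every hypothesis is either kernel-proved in this package or a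
verbatim quotation of a PUBLISHED theorem with page reference. The manuscript(s) under audit are NOT citable for their own disputed steps — they
are the thing under adjudication; programme-internal (2001/route/tribunal) claims are never citable.»

CONTENT = the chart-generic `RelInvPeriodisedChartMinOpRecord` theorems at the seven letters of `RelInvPeriodisedComb` (root offset `ctrOff (d+1) Lc`, `ctr = toSite ∘ ctrOff` by
`rfl`; presentation of record: fields `(s, α) ↦ (s, inl α)`, `τ₁ := combRowsT (ctr (d+1) Lc) Lc M` on the field slots, coarse multipliers by any injective `inr`-valued `fμ`
with `hcoarse`): `torus_minOp_inl_comb`, `torus_minOpL_inl_comb`, `torus_minOp_submatrix_inl_comb`, `torus_minOpL_submatrix_inl_comb`, `torus_flucCov_apply_comb`,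
`torus_flucCov_eq_comb` — every `d`, every `Lc ≥ 1`, EVERY level `j`, every box `M` with `Lc ∣ M_i`.  [folklore] one-line instances; nothing of an1's ∕ an2's ∕ leaf-03's
restated; no `Prop`, no `def`, nothing cited, 0 sorry; discharges NO binder of row D1; NOT the dictionary's `hId₁`, NOT (J-a), NOT (T-ID), NOT SDF, NOT D1, NOT BetaPertH,
NOT continuum, NOT Clay; 0 estimates.  Unit `b2b-balaban-beta-d1-formalise-leaf-05` (gen 29), 2026-08-22; no existing file touched.
-/

noncomputable section

open scoped BigOperators Matrix

namespace Summit.QuantumFields.BalabanUV.Beta.FP.RelInvPeriodisedCombMinOp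

open Matrix
open Literature.Probability.LatticeModels (Torus.proj)
open Literature.MathematicalPhysics.QuantumFieldTheory.Balaban1983to89
open Literature.MathematicalPhysics.QuantumFieldTheory.Balaban1983to89.Beta
open Literature.MathematicalPhysics.QuantumFieldTheory.Balaban1983to89.Beta.Composition (kkt)
open Literature.MathematicalPhysics.QuantumFieldTheory.Balaban1983to89.Beta.CompositionSingular (effForm flucCov minOp minOpL)
open B6Lemma24Torus (pbox)
open ExpKernelCalculus (MKer)
open AffineAveraging (Site box toSite)
open AveragingContoursRooted (ctr ctrOff ctrOff_mem_box)
open OneStepResolventKernel (Fib)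
open Summit.QuantumFields.BalabanUV.Beta.AxialDressingRooted (axEc one_le_of_neZero)
open Summit.QuantumFields.BalabanUV.Beta.SymShiftedSpread (bhKStepSh)
open Summit.QuantumFields.BalabanUV.Beta.DshAn1 (Dsh)
open Summit.QuantumFields.BalabanUV.Beta.CombChartStepJets (GcombSh)
open Summit.QuantumFields.BalabanUV.Beta.CombChartContactFactor (spr_GcombSh)
open Summit.QuantumFields.BalabanUV.Beta.FP.KernelPeriodisationFib (Idx perF)
open Summit.QuantumFields.BalabanUV.Beta.FP.TorusCombRows (Res combRowsT)
open Summit.QuantumFields.BalabanUV.Beta.FP.RelInvPeriodisedComb (spr_bhKStepSh_Dsh shiftK_GcombSh' shiftK_bhKStepSh relInv_GcombSh_bhKStepSh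
  bhKStepSh_inr_inr bhKStepSh_inl_inr_eq_neg)
open Summit.QuantumFields.BalabanUV.Beta.FP.RelInvPeriodisedChartMinOpRecord (torus_minOp_inl_of_relInv torus_minOpL_inl_of_relInv
  torus_minOp_submatrix_inl_of_relInv torus_minOpL_submatrix_inl_of_relInv torus_flucCov_apply_of_relInv torus_flucCov_eq_of_relInv)

variable {d : ℕ} {Lc : ℕ} [NeZero Lc] (M : Fin (d + 1) → ℕ) [∀ μ, NeZero (M μ)]

set_option synthInstance.maxSize 1024 in
/-- **[folklore] THE `μ`-COLUMNS OF THE MINIMISER OF THE COMB-SLICED PERIODISED SYSTEM, CHART (III′)** (presentation of record: fields `(s, α) ↦ (s, inl α)`,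
`τ₁ := combRowsT (ctr (d + 1) Lc) Lc M` on the field slots, coarse multipliers by any injective `inr`-valued `fμ` with `hcoarse`):
`minOp H₀ [Q₁₀;τ₁] (s, α) (inl a) = axEc (ctr (d + 1) Lc) Lc s s (inl α) (inl α) · Â ((s, inl α)) (fμ a)`,
`Â′ := perF M (GcombSh Lc j)` — `+Â` on the non-comb field slots, `0` on the comb slots. -/
theorem torus_minOp_inl_comb (hM : ∀ i, Lc ∣ M i) (j : ℕ)
    {μ : Type*} [Fintype μ] [DecidableEq μ] (fμ : μ → Idx M (Fib d)) (hfμ : Function.Injective fμ)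
    (hμ : ∀ a : μ, ∃ m : Fin (d + 1), (fμ a).2 = Sum.inr m)
    (hcoarse : ∀ (s : ↥(pbox M)) (m : Fin (d + 1)), ((s, Sum.inr m) : Idx M (Fib d)) ∈ Set.range fμ ↔ Torus.proj Lc (s : Site (d + 1)) = 0)
    (b : ↥(pbox M) × Fin (d + 1)) (a : μ) :
    minOp ((perF M (bhKStepSh d Lc (Dsh Lc) j)).submatrix (fun b : ↥(pbox M) × Fin (d + 1) => ((b.1, Sum.inl b.2) : Idx M (Fib d)))
          (fun b : ↥(pbox M) × Fin (d + 1) => ((b.1, Sum.inl b.2) : Idx M (Fib d))))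
        (fromRows
          ((perF M (bhKStepSh d Lc (Dsh Lc) j)).submatrix fμ (fun b : ↥(pbox M) × Fin (d + 1) => ((b.1, Sum.inl b.2) : Idx M (Fib d))))
          ((combRowsT (ctr (d + 1) Lc) Lc M).submatrix id (fun b : ↥(pbox M) × Fin (d + 1) => ((b.1, Sum.inl b.2) : Idx M (Fib d)))))
        b (Sum.inl a)
      = axEc (ctr (d + 1) Lc) Lc (b.1 : Site (d + 1)) (b.1 : Site (d + 1)) (Sum.inl b.2) (Sum.inl b.2)
          * perF M (GcombSh (d := d) Lc j) (b.1, Sum.inl b.2) (fμ a) :=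
  torus_minOp_inl_of_relInv M (ctrOff_mem_box (one_le_of_neZero Lc)) hM (spr_GcombSh j) (spr_bhKStepSh_Dsh j) (shiftK_GcombSh' j)
    (fun t => shiftK_bhKStepSh t j) (relInv_GcombSh_bhKStepSh j) (bhKStepSh_inr_inr j) (bhKStepSh_inl_inr_eq_neg j) fμ hfμ hμ hcoarse b a

set_option synthInstance.maxSize 1024 in
/-- **[folklore] THE `μ`-ROWS OF THE LEFT COMPANION `minOpL`** (same presentation):
`minOpL H₀ [Q₁₀;τ₁] (inl a) (s, α) = −(axEc (ctr (d + 1) Lc) Lc s s (inl α) (inl α) · Â (fμ a) ((s, inl α)))`. -/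
theorem torus_minOpL_inl_comb (hM : ∀ i, Lc ∣ M i) (j : ℕ)
    {μ : Type*} [Fintype μ] [DecidableEq μ] (fμ : μ → Idx M (Fib d)) (hfμ : Function.Injective fμ)
    (hμ : ∀ a : μ, ∃ m : Fin (d + 1), (fμ a).2 = Sum.inr m)
    (hcoarse : ∀ (s : ↥(pbox M)) (m : Fin (d + 1)), ((s, Sum.inr m) : Idx M (Fib d)) ∈ Set.range fμ ↔ Torus.proj Lc (s : Site (d + 1)) = 0)
    (a : μ) (b : ↥(pbox M) × Fin (d + 1)) :
    minOpL ((perF M (bhKStepSh d Lc (Dsh Lc) j)).submatrix (fun b : ↥(pbox M) × Fin (d + 1) => ((b.1, Sum.inl b.2) : Idx M (Fib d)))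
          (fun b : ↥(pbox M) × Fin (d + 1) => ((b.1, Sum.inl b.2) : Idx M (Fib d))))
        (fromRows
          ((perF M (bhKStepSh d Lc (Dsh Lc) j)).submatrix fμ (fun b : ↥(pbox M) × Fin (d + 1) => ((b.1, Sum.inl b.2) : Idx M (Fib d))))
          ((combRowsT (ctr (d + 1) Lc) Lc M).submatrix id (fun b : ↥(pbox M) × Fin (d + 1) => ((b.1, Sum.inl b.2) : Idx M (Fib d)))))
        (Sum.inl a) b
      = -(axEc (ctr (d + 1) Lc) Lc (b.1 : Site (d + 1)) (b.1 : Site (d + 1)) (Sum.inl b.2) (Sum.inl b.2)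
          * perF M (GcombSh (d := d) Lc j) (fμ a) (b.1, Sum.inl b.2)) :=
  torus_minOpL_inl_of_relInv M (ctrOff_mem_box (one_le_of_neZero Lc)) hM (spr_GcombSh j) (spr_bhKStepSh_Dsh j) (shiftK_GcombSh' j)
    (fun t => shiftK_bhKStepSh t j) (relInv_GcombSh_bhKStepSh j) (bhKStepSh_inr_inr j) (bhKStepSh_inl_inr_eq_neg j) fμ hfμ hμ hcoarse a b

set_option synthInstance.maxSize 1024 in
/-- **[folklore] MATRIX FORM: the `μ`-COLUMN BLOCK of the minimiser** — `(minOp H₀ [Q₁₀;τ₁]).submatrix id inl = of (fun (s,α) a ↦ axEc s s α α · Â (s, inl α) (fμ a))`. -/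
theorem torus_minOp_submatrix_inl_comb (hM : ∀ i, Lc ∣ M i) (j : ℕ)
    {μ : Type*} [Fintype μ] [DecidableEq μ] (fμ : μ → Idx M (Fib d)) (hfμ : Function.Injective fμ)
    (hμ : ∀ a : μ, ∃ m : Fin (d + 1), (fμ a).2 = Sum.inr m)
    (hcoarse : ∀ (s : ↥(pbox M)) (m : Fin (d + 1)), ((s, Sum.inr m) : Idx M (Fib d)) ∈ Set.range fμ ↔ Torus.proj Lc (s : Site (d + 1)) = 0) :
    (minOp ((perF M (bhKStepSh d Lc (Dsh Lc) j)).submatrix (fun b : ↥(pbox M) × Fin (d + 1) => ((b.1, Sum.inl b.2) : Idx M (Fib d)))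
          (fun b : ↥(pbox M) × Fin (d + 1) => ((b.1, Sum.inl b.2) : Idx M (Fib d))))
        (fromRows
          ((perF M (bhKStepSh d Lc (Dsh Lc) j)).submatrix fμ (fun b : ↥(pbox M) × Fin (d + 1) => ((b.1, Sum.inl b.2) : Idx M (Fib d))))
          ((combRowsT (ctr (d + 1) Lc) Lc M).submatrix id (fun b : ↥(pbox M) × Fin (d + 1) => ((b.1, Sum.inl b.2) : Idx M (Fib d)))))).submatrix
        id Sum.inl
      = Matrix.of fun (b : ↥(pbox M) × Fin (d + 1)) (a : μ) =>
          axEc (ctr (d + 1) Lc) Lc (b.1 : Site (d + 1)) (b.1 : Site (d + 1)) (Sum.inl b.2) (Sum.inl b.2)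
            * perF M (GcombSh (d := d) Lc j) (b.1, Sum.inl b.2) (fμ a) :=
  torus_minOp_submatrix_inl_of_relInv M (ctrOff_mem_box (one_le_of_neZero Lc)) hM (spr_GcombSh j) (spr_bhKStepSh_Dsh j) (shiftK_GcombSh' j)
    (fun t => shiftK_bhKStepSh t j) (relInv_GcombSh_bhKStepSh j) (bhKStepSh_inr_inr j) (bhKStepSh_inl_inr_eq_neg j) fμ hfμ hμ hcoarse

set_option synthInstance.maxSize 1024 in
/-- **[folklore] MATRIX FORM: the `μ`-ROW BLOCK of the left companion** — `(minOpL H₀ [Q₁₀;τ₁]).submatrix inl id = −of (fun a (s,α) ↦ axEc s s α α · Â (fμ a) (s, inl α))`. -/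
theorem torus_minOpL_submatrix_inl_comb (hM : ∀ i, Lc ∣ M i) (j : ℕ)
    {μ : Type*} [Fintype μ] [DecidableEq μ] (fμ : μ → Idx M (Fib d)) (hfμ : Function.Injective fμ)
    (hμ : ∀ a : μ, ∃ m : Fin (d + 1), (fμ a).2 = Sum.inr m)
    (hcoarse : ∀ (s : ↥(pbox M)) (m : Fin (d + 1)), ((s, Sum.inr m) : Idx M (Fib d)) ∈ Set.range fμ ↔ Torus.proj Lc (s : Site (d + 1)) = 0) :
    (minOpL ((perF M (bhKStepSh d Lc (Dsh Lc) j)).submatrix (fun b : ↥(pbox M) × Fin (d + 1) => ((b.1, Sum.inl b.2) : Idx M (Fib d)))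
          (fun b : ↥(pbox M) × Fin (d + 1) => ((b.1, Sum.inl b.2) : Idx M (Fib d))))
        (fromRows
          ((perF M (bhKStepSh d Lc (Dsh Lc) j)).submatrix fμ (fun b : ↥(pbox M) × Fin (d + 1) => ((b.1, Sum.inl b.2) : Idx M (Fib d))))
          ((combRowsT (ctr (d + 1) Lc) Lc M).submatrix id (fun b : ↥(pbox M) × Fin (d + 1) => ((b.1, Sum.inl b.2) : Idx M (Fib d)))))).submatrix
        Sum.inl id
      = -Matrix.of fun (a : μ) (b : ↥(pbox M) × Fin (d + 1)) =>
          axEc (ctr (d + 1) Lc) Lc (b.1 : Site (d + 1)) (b.1 : Site (d + 1)) (Sum.inl b.2) (Sum.inl b.2)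
            * perF M (GcombSh (d := d) Lc j) (fμ a) (b.1, Sum.inl b.2) :=
  torus_minOpL_submatrix_inl_of_relInv M (ctrOff_mem_box (one_le_of_neZero Lc)) hM (spr_GcombSh j) (spr_bhKStepSh_Dsh j) (shiftK_GcombSh' j)
    (fun t => shiftK_bhKStepSh t j) (relInv_GcombSh_bhKStepSh j) (bhKStepSh_inr_inr j) (bhKStepSh_inl_inr_eq_neg j) fμ hfμ hμ hcoarse

set_option synthInstance.maxSize 1024 in
/-- **[folklore] THE FLUCTUATION COVARIANCE OF THE COMB-SLICED PERIODISED LEVEL-`j` SYSTEM, ENTRYWISE** (same presentation):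
`flucCov H₀ [Q₁₀;τ₁] (s,α) (s',α') = axEc s s (inl α) (inl α) · axEc s' s' (inl α') (inl α') · Â (s, inl α) (s', inl α')` — `+Â` between non-comb field slots,
`0` as soon as one slot is on the comb. -/
theorem torus_flucCov_apply_comb (hM : ∀ i, Lc ∣ M i) (j : ℕ)
    {μ : Type*} [Fintype μ] [DecidableEq μ] (fμ : μ → Idx M (Fib d)) (hfμ : Function.Injective fμ)
    (hμ : ∀ a : μ, ∃ m : Fin (d + 1), (fμ a).2 = Sum.inr m)
    (hcoarse : ∀ (s : ↥(pbox M)) (m : Fin (d + 1)), ((s, Sum.inr m) : Idx M (Fib d)) ∈ Set.range fμ ↔ Torus.proj Lc (s : Site (d + 1)) = 0)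
    (b b' : ↥(pbox M) × Fin (d + 1)) :
    flucCov ((perF M (bhKStepSh d Lc (Dsh Lc) j)).submatrix (fun b : ↥(pbox M) × Fin (d + 1) => ((b.1, Sum.inl b.2) : Idx M (Fib d)))
          (fun b : ↥(pbox M) × Fin (d + 1) => ((b.1, Sum.inl b.2) : Idx M (Fib d))))
        (fromRows
          ((perF M (bhKStepSh d Lc (Dsh Lc) j)).submatrix fμ (fun b : ↥(pbox M) × Fin (d + 1) => ((b.1, Sum.inl b.2) : Idx M (Fib d))))
          ((combRowsT (ctr (d + 1) Lc) Lc M).submatrix id (fun b : ↥(pbox M) × Fin (d + 1) => ((b.1, Sum.inl b.2) : Idx M (Fib d)))))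
        b b'
      = axEc (ctr (d + 1) Lc) Lc (b.1 : Site (d + 1)) (b.1 : Site (d + 1)) (Sum.inl b.2) (Sum.inl b.2)
          * (axEc (ctr (d + 1) Lc) Lc (b'.1 : Site (d + 1)) (b'.1 : Site (d + 1)) (Sum.inl b'.2) (Sum.inl b'.2)
            * perF M (GcombSh (d := d) Lc j) (b.1, Sum.inl b.2) (b'.1, Sum.inl b'.2)) :=
  torus_flucCov_apply_of_relInv M (ctrOff_mem_box (one_le_of_neZero Lc)) hM (spr_GcombSh j) (spr_bhKStepSh_Dsh j) (shiftK_GcombSh' j)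
    (fun t => shiftK_bhKStepSh t j) (relInv_GcombSh_bhKStepSh j) (bhKStepSh_inr_inr j) (bhKStepSh_inl_inr_eq_neg j) fμ hfμ hμ hcoarse b b'

set_option synthInstance.maxSize 1024 in
/-- **[folklore] MATRIX FORM: the FLUCTUATION COVARIANCE** — `flucCov H₀ [Q₁₀;τ₁] = of (fun (s,α) (s',α') ↦ axEc s s α α · (axEc s' s' α' α' · Â (s, inl α) (s', inl α')))`. -/
theorem torus_flucCov_eq_comb (hM : ∀ i, Lc ∣ M i) (j : ℕ)
    {μ : Type*} [Fintype μ] [DecidableEq μ] (fμ : μ → Idx M (Fib d)) (hfμ : Function.Injective fμ)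
    (hμ : ∀ a : μ, ∃ m : Fin (d + 1), (fμ a).2 = Sum.inr m)
    (hcoarse : ∀ (s : ↥(pbox M)) (m : Fin (d + 1)), ((s, Sum.inr m) : Idx M (Fib d)) ∈ Set.range fμ ↔ Torus.proj Lc (s : Site (d + 1)) = 0) :
    flucCov ((perF M (bhKStepSh d Lc (Dsh Lc) j)).submatrix (fun b : ↥(pbox M) × Fin (d + 1) => ((b.1, Sum.inl b.2) : Idx M (Fib d)))
          (fun b : ↥(pbox M) × Fin (d + 1) => ((b.1, Sum.inl b.2) : Idx M (Fib d))))
        (fromRows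
          ((perF M (bhKStepSh d Lc (Dsh Lc) j)).submatrix fμ (fun b : ↥(pbox M) × Fin (d + 1) => ((b.1, Sum.inl b.2) : Idx M (Fib d))))
          ((combRowsT (ctr (d + 1) Lc) Lc M).submatrix id (fun b : ↥(pbox M) × Fin (d + 1) => ((b.1, Sum.inl b.2) : Idx M (Fib d)))))
      = Matrix.of fun (b b' : ↥(pbox M) × Fin (d + 1)) =>
          axEc (ctr (d + 1) Lc) Lc (b.1 : Site (d + 1)) (b.1 : Site (d + 1)) (Sum.inl b.2) (Sum.inl b.2)
            * (axEc (ctr (d + 1) Lc) Lc (b'.1 : Site (d + 1)) (b'.1 : Site (d + 1)) (Sum.inl b'.2) (Sum.inl b'.2)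
              * perF M (GcombSh (d := d) Lc j) (b.1, Sum.inl b.2) (b'.1, Sum.inl b'.2)) :=
  torus_flucCov_eq_of_relInv M (ctrOff_mem_box (one_le_of_neZero Lc)) hM (spr_GcombSh j) (spr_bhKStepSh_Dsh j) (shiftK_GcombSh' j)
    (fun t => shiftK_bhKStepSh t j) (relInv_GcombSh_bhKStepSh j) (bhKStepSh_inr_inr j) (bhKStepSh_inl_inr_eq_neg j) fμ hfμ hμ hcoarse

end Summit.QuantumFields.BalabanUV.Beta.FP.RelInvPeriodisedCombMinOp

end
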